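import Summits.CriticalPhenomena.PercolationContinuityZ3.Theses.PercShatteringRace
import Summits.CriticalPhenomena.PercolationContinuityZ3.Theorems.PercNonProliferationSubpolynomialBlockingStubAnnulusCrossingRenorm
import Literature.Probability.Percolation.SharpnessDCTProofs
import Literature.Probability.Percolation.LatticeSymmetry
import HarnessLib

/-!
# Crux `PercShatteringRace.NearLinearTwoClusterDecay` (stmt-CriticalPhenomena-5785), line `critical-orange-peeling` — stub `aspectCrossing_renorm`

Helper file for the lead's skeleton of the line `critical-orange-peeling` (van den Berg–van
Engelenburg 2022 programme, bounded aspect) of the crux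
`Summit.CriticalPhenomena.PercolationContinuityZ3.Theses.PercShatteringRace.NearLinearTwoClusterDecay`.
Proves exactly the registered stub signature `aspectCrossing_renorm`; lands with
`--supports stmt-CriticalPhenomena-5785`.

## The statement (aspect-`M` renormalisation inequality `u_M(20n) ≤ ((100M)³ · u_M(n))²`)

`u_M(n) = P_p(cross(n, Mn))` is the probability that `Λ_n = [-n, n]³` is joined to `∂ⁱⁿΛ_{Mn}` by
an open path inside `Λ_{Mn}` (bond percolation on `ℤ³`, any `p`); for `M ≥ 2`, `n ≥ 1`:
`u_M(20n) ≤ ((100M)³ · u_M(n))²` — the aspect-`M` twin of `a_{20n} ≤ (100^d a_n)²`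
(`…Theorems.SubpolynomialBlocking.stub_annulusCrossing_renorm`, whose proof is adapted; only
independence of disjoint shells is used, no BK inequality).

## The argument (general `d`, inner radius `n ≥ 1`, outer radius `m ≥ 2n`)

Work on lattice configurations `ω ⊆ E(ℤ^d)` (`DCT16.real_mono_of_forall_subset_edgeSet`); let
`T_v` be the translate by `v` of `cross(n, m)` (an `openCrossing` of three translated sets),
`P_p(T_v) = P_p(cross(n, m))` (`real_openCrossing_shift`).
* MARKERS (`AspectRenorm.exists_grid_crossing`). An open path inside `Λ_{20m}` from `u ∈ Λ_{20n}`
  to `w ∈ ∂ⁱⁿΛ_{20m}` has a LAST EXIT edge `a ∼ b` from `Λ_K` (`PathIn.last_exit`), `‖b‖_∞ = K + 1`;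
  round `b` down to the grid `n ℤ^d`, `x = n • z`, `z_i = ⌊b_i / n⌋`: `b ∈ x + Λ_n`,
  `x ∈ Λ_{K+n} ∖ Λ_{K-n}`, `z ∈ Λ_G` (`K + 1 ≤ G n`), `w ∉ x + Λ_m` (`‖w‖_∞ > K + n + m`); the FIRST
  EXIT of the remaining path from `x + Λ_m` (`PathIn.exit`) gives `ω ∈ T_x`. With `K₁ = 20n`,
  `K₂ = 2m + 23n`: `x₁ ∈ Λ_{21n} ∖ Λ_{19n}`, `x₂ ∈ Λ_{2m+24n} ∖ Λ_{2m+22n}`, `ω ∈ T_{x₁} ∩ T_{x₂}`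
  (`AspectRenorm.mem_inter_of_mem_crossing`; `21n + m < 20m`, `3m + 24n < 20m`).
* DISJOINT SUPPORTS. `T_v`, `v ∈ I₁`, is determined by the pairs inside `S₁ = Λ_{m+21n}`; `T_v`,
  `v ∈ I₂`, by the pairs inside `S₂ = Λ_{3m+24n} ∖ Λ_{m+22n}` (`DCT16.determinedBy_openConnIn`);
  `S₁ ∩ S₂ = ∅`, so `P(U₁ ∩ U₂) = P(U₁) P(U₂)` for `U_k = ⋃_{v ∈ I_k} T_v`
  (`DCT16.real_inter_of_determinedBy_disjoint`).
* UNION BOUND. `P(U_k) ≤ |I_k| u ≤ (2G+1)^d u` (`measureReal_biUnion_finset_le`, `card_box`); for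
  `d = 3`, `m = Mn`, `G = 2M + 25` the constant is `(4M+51)³ ≤ (100M)³`.

No new definitions (index sets and shells are explicit `Finset` expressions); the translation
lemmas `mem_image_add_iff`, `disjoint_sym2` are reused from the aspect-2 file.
-/

noncomputable section

namespace Summit.CriticalPhenomena.PercolationContinuityZ3.Theorems.NearLinearTwoClusterDecay.Negative

open MeasureTheory Filter Topology
open Literature.Probability.LatticeModels Literature.Probability.Percolation
open Literature.Probability.Percolation.DCT16
open Summit.CriticalPhenomena.PercolationContinuityZ3.Theorems.SubpolynomialBlocking.StubAnnulusCrossingRenorm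
  (mem_image_add_iff disjoint_sym2)

namespace AspectRenorm

/-! ### Geometry: translated boxes, local crossings, markers on the grid `n ℤ^d` -/

/-- **Local crossing by first exit.** On a lattice configuration `ω ⊆ E(ℤ^d)`, an open path (inside
any set) from a point `b ∈ x + Λ_n` to a point `w ∉ x + Λ_m` (`n ≤ m`) contains an open path inside
`x + Λ_m` from `b` to a point of `x + ∂ⁱⁿΛ_m`: stop at the first exit from `x + Λ_m`
(`PathIn.exit`); the last vertex before the exit has a lattice neighbour outside, i.e. is a
translate of an inner-boundary vertex (`mem_innerBoundary_iff`, `DCT16.zdGraph_adj_sub_iff`). -/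
theorem mem_openCrossing_of_pathIn {d n m : ℕ} (hnm : n ≤ m) {ω : BondConfig (Site d)}
    (hω : ω ⊆ (zdGraph d).edgeSet) {A : Set (Site d)} {x b w : Site d}
    (h : PathIn (openGraph ω) A b w) (hb : b - x ∈ box d n) (hw : w - x ∉ box d m) :
    ω ∈ openCrossing ((· + x) '' (↑(box d m) : Set (Site d)))
      ((· + x) '' (↑(box d n) : Set (Site d)))
      ((· + x) '' (↑(innerBoundary (zdGraph d) (box d m)) : Set (Site d))) := by
  have hbR : b ∈ (· + x) '' (↑(box d m) : Set (Site d)) :=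
    (mem_image_add_iff x b _).2 (box_mono d hnm hb)
  have hwR : w ∉ (· + x) '' (↑(box d m) : Set (Site d)) := fun h' =>
    hw ((mem_image_add_iff x w _).1 h')
  obtain ⟨a', b', ha', hb', -, hab', hpath⟩ := h.exit hbR hwR
  refine ⟨b, (mem_image_add_iff x b _).2 hb, a', (mem_image_add_iff x a' _).2 ?_,
    mem_openConnIn_of_pathIn (hpath.mono Set.inter_subset_left)⟩
  rw [mem_innerBoundary_iff]
  exact ⟨(mem_image_add_iff x a' _).1 ha', b' - x,
    fun hb'' => hb' ((mem_image_add_iff x b' _).2 hb''),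
    (zdGraph_adj_sub_iff x a' b').2 (adj_of_openGraph_adj hω hab')⟩

/-- **Marker on the grid.** On a lattice configuration `ω ⊆ E(ℤ^d)`, let an open path run from
`u ∈ Λ_K` to `w ∉ Λ_{K'}`, where `1 ≤ n ≤ m`, `Mₗ + n ≤ K`, `K + n ≤ L`, `K + n + m ≤ K'`,
`K + 1 ≤ G n`. Its last exit edge from `Λ_K` (`PathIn.last_exit`) ends at a vertex `b` with
`‖b‖_∞ = K + 1` (`DCT16.mem_box_succ_of_adj`); rounding `b` down to the grid, `x = n • z` with
`z_i = ⌊b_i / n⌋`, gives `z ∈ Λ_G`, `x ∈ Λ_L ∖ Λ_{Mₗ}`, `b ∈ x + Λ_n` and `w ∉ x + Λ_m`, so the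
remaining path from `b` to `w` produces the local crossing `ω ∈ T_x`
(`mem_openCrossing_of_pathIn`). -/
theorem exists_grid_crossing {d n m K L Mₗ K' G : ℕ} (hn : 1 ≤ n) (hnm : n ≤ m) (hL : K + n ≤ L)
    (hM : Mₗ + n ≤ K) (hK' : K + n + m ≤ K') (hG : K + 1 ≤ G * n) {ω : BondConfig (Site d)}
    (hω : ω ⊆ (zdGraph d).edgeSet) {A : Set (Site d)} {u w : Site d}
    (h : PathIn (openGraph ω) A u w) (hu : u ∈ box d K) (hw : w ∉ box d K') :
    ∃ z ∈ box d G, ((n : ℤ) • z ∈ box d L ∧ (n : ℤ) • z ∉ box d Mₗ) ∧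
      ω ∈ openCrossing ((· + (n : ℤ) • z) '' (↑(box d m) : Set (Site d)))
        ((· + (n : ℤ) • z) '' (↑(box d n) : Set (Site d)))
        ((· + (n : ℤ) • z) '' (↑(innerBoundary (zdGraph d) (box d m)) : Set (Site d))) := by
  have hwK : w ∉ (↑(box d K) : Set (Site d)) := fun h' =>
    hw (box_mono d (by omega) (Finset.mem_coe.1 h'))
  obtain ⟨a, b, ha, -, hb, hab, Q⟩ :=
    h.last_exit (C := (↑(box d K) : Set (Site d))) (Finset.mem_coe.2 hu) hwK
  have hbK : b ∈ box d (K + 1) :=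
    DCT16.mem_box_succ_of_adj (Finset.mem_coe.1 ha) (adj_of_openGraph_adj hω hab)
  rw [mem_box] at hbK
  have hbK' : ¬ ∀ i, -(K : ℤ) ≤ b i ∧ b i ≤ K := fun h' => hb (Finset.mem_coe.2 (mem_box.2 h'))
  obtain ⟨j, hj⟩ := not_forall.1 hbK'
  -- grid rounding `z i = ⌊b i / n⌋`
  obtain ⟨z, hz⟩ : ∃ z : Site d, ∀ i, z i = b i / (n : ℤ) := ⟨fun i => b i / (n : ℤ), fun _ => rfl⟩
  have hround : ∀ i, (n : ℤ) * z i ≤ b i ∧ b i < (n : ℤ) * z i + n := fun i => by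
    have h1 := Int.mul_ediv_add_emod (b i) n
    have h2 := Int.emod_nonneg (b i) (show (n : ℤ) ≠ 0 by omega)
    have h3 := Int.emod_lt_of_pos (b i) (show (0 : ℤ) < n by omega)
    rw [← hz i] at h1
    constructor <;> omega
  have hGn : (K : ℤ) + 1 ≤ (G : ℤ) * (n : ℤ) := by exact_mod_cast hG
  refine ⟨z, ?_, ⟨?_, ?_⟩, mem_openCrossing_of_pathIn hnm hω Q ?_ ?_⟩
  · -- `z ∈ Λ_G`: `|b i| ≤ K + 1 ≤ G n`
    rw [mem_box]
    intro i
    have hi := hbK i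
    rw [hz i]
    exact ⟨Int.le_ediv_of_mul_le (by omega) (by rw [neg_mul]; push_cast at hi ⊢; omega),
      Int.ediv_le_of_le_mul (by omega) (by push_cast at hi ⊢; omega)⟩
  · -- `n • z ∈ Λ_L`
    rw [mem_box]
    intro i
    have hi := hbK i
    have hr := hround i
    simp only [Pi.smul_apply, smul_eq_mul]
    push_cast at hi ⊢
    omega
  · -- `n • z ∉ Λ_{Mₗ}`: the coordinate `j` with `|b j| = K + 1`
    rw [mem_box, not_forall]
    refine ⟨j, ?_⟩
    have hr := hround j
    simp only [Pi.smul_apply, smul_eq_mul]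
    omega
  · -- `b ∈ n • z + Λ_n`
    rw [mem_box]
    intro i
    have hr := hround i
    simp only [Pi.sub_apply, Pi.smul_apply, smul_eq_mul]
    omega
  · -- `w ∉ n • z + Λ_m`: `‖w‖_∞ ≥ K' + 1 > ‖n • z‖_∞ + m`
    rw [mem_box, not_forall] at hw ⊢
    obtain ⟨i, hi⟩ := hw
    refine ⟨i, ?_⟩
    have hr := hround i
    have hi' := hbK i
    simp only [Pi.sub_apply, Pi.smul_apply, smul_eq_mul]
    push_cast at hi hi' ⊢
    omega

/-- **Box containment.** If `v ∈ Λ_L` and `z ∈ Λ_m` with `L + m ≤ L'`, then `z + v ∈ Λ_{L'}`. -/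
theorem add_mem_box {d m L L' : ℕ} (hL : L + m ≤ L') {v z : Site d} (hv : v ∈ box d L)
    (hz : z ∈ box d m) : z + v ∈ box d L' := by
  rw [mem_box] at hv hz ⊢
  intro i
  have h1 := hv i
  have h2 := hz i
  simp only [Pi.add_apply]
  omega

/-- **Shell containment.** If `v ∈ Λ_L ∖ Λ_{Mₗ}` with `L + m ≤ L'` and `M' + m ≤ Mₗ`, then
`v + Λ_m ⊆ Λ_{L'} ∖ Λ_{M'}`. -/
theorem add_mem_sdiff {d m L Mₗ L' M' : ℕ} (hL : L + m ≤ L') (hM : M' + m ≤ Mₗ)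
    {v z : Site d} (hv : v ∈ box d L) (hv' : v ∉ box d Mₗ) (hz : z ∈ box d m) :
    z + v ∈ box d L' \ box d M' := by
  refine Finset.mem_sdiff.2 ⟨add_mem_box hL hv hz, fun h' => ?_⟩
  rw [mem_box] at hv' hz h'
  obtain ⟨j, hj⟩ := not_forall.1 hv'
  have h1 := h' j
  have h2 := hz j
  simp only [Pi.add_apply] at h1
  omega

/-- **Two markers.** On a lattice configuration `ω ⊆ E(ℤ^d)` crossing from `Λ_{20n}` to
`∂ⁱⁿΛ_{20m}` inside `Λ_{20m}` (`n ≥ 1`, `m ≥ 2n`, `2m + 23n + 1 ≤ G n`), there are grid points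
`x₁ ∈ nΛ_G ∩ Λ_{21n} ∖ Λ_{19n}` and `x₂ ∈ nΛ_G ∩ Λ_{2m+24n} ∖ Λ_{2m+22n}` with `ω ∈ T_{x₁} ∩ T_{x₂}`
(`exists_grid_crossing` with `K = 20n` and `K = 2m + 23n`, applied to the open path of
`DCT16.mem_openConnIn_iff_pathIn`; the endpoint on `∂ⁱⁿΛ_{20m}` is outside `Λ_{m+21n}` and
`Λ_{3m+24n}`, `DCT16.notMem_box_of_mem_innerBoundary_box`). -/
theorem mem_inter_of_mem_crossing {d n m G : ℕ} (hn : 1 ≤ n) (hm : 2 * n ≤ m)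
    (hG : 2 * m + 23 * n + 1 ≤ G * n) {ω : BondConfig (Site d)} (hω : ω ⊆ (zdGraph d).edgeSet)
    (h : ω ∈ {ω | ∃ x ∈ box d (20 * n), ∃ y ∈ innerBoundary (zdGraph d) (box d (20 * m)),
      ω ∈ openConnIn (↑(box d (20 * m)) : Set (Site d)) x y}) :
    ω ∈ (⋃ v ∈ ((((box d G).image fun z : Site d => (n : ℤ) • z) ∩ box d (21 * n)) \
          box d (19 * n)),
        openCrossing ((· + v) '' (↑(box d m) : Set (Site d)))
          ((· + v) '' (↑(box d n) : Set (Site d)))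
          ((· + v) '' (↑(innerBoundary (zdGraph d) (box d m)) : Set (Site d)))) ∩
      (⋃ v ∈ ((((box d G).image fun z : Site d => (n : ℤ) • z) ∩ box d (2 * m + 24 * n)) \
          box d (2 * m + 22 * n)),
        openCrossing ((· + v) '' (↑(box d m) : Set (Site d)))
          ((· + v) '' (↑(box d n) : Set (Site d)))
          ((· + v) '' (↑(innerBoundary (zdGraph d) (box d m)) : Set (Site d)))) := by
  obtain ⟨u, hu, w, hw, huw⟩ := h
  have P := mem_openConnIn_iff_pathIn.1 huw
  have hw₁ : w ∉ box d (21 * n + m) := notMem_box_of_mem_innerBoundary_box (by omega) hw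
  have hw₂ : w ∉ box d (3 * m + 24 * n) := notMem_box_of_mem_innerBoundary_box (by omega) hw
  have hu₂ : u ∈ box d (2 * m + 23 * n) := box_mono d (by omega) hu
  obtain ⟨z₁, hz₁, ⟨hL₁, hM₁⟩, hT₁⟩ := exists_grid_crossing (m := m) (K := 20 * n) (L := 21 * n)
    (Mₗ := 19 * n) (K' := 21 * n + m) (G := G) hn (by omega) (by omega) (by omega) (by omega)
    (by omega) hω P hu hw₁
  obtain ⟨z₂, hz₂, ⟨hL₂, hM₂⟩, hT₂⟩ := exists_grid_crossing (m := m) (K := 2 * m + 23 * n)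
    (L := 2 * m + 24 * n) (Mₗ := 2 * m + 22 * n) (K' := 3 * m + 24 * n) (G := G) hn (by omega)
    (by omega) (by omega) (by omega) (by omega) hω P hu₂ hw₂
  refine ⟨Set.mem_biUnion (Finset.mem_coe.2 ?_) hT₁, Set.mem_biUnion (Finset.mem_coe.2 ?_) hT₂⟩
  · exact Finset.mem_sdiff.2 ⟨Finset.mem_inter.2 ⟨Finset.mem_image_of_mem _ hz₁, hL₁⟩, hM₁⟩
  · exact Finset.mem_sdiff.2 ⟨Finset.mem_inter.2 ⟨Finset.mem_image_of_mem _ hz₂, hL₂⟩, hM₂⟩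

/-! ### Probability: translation invariance, locality, independence, union bound -/

/-- **Translation invariance**: `P_p(T_v) = P_p(cross(n, m))` for every `v`
(`real_openCrossing_shift`, Grimmett 1999 §1.6; the crossing event is the open crossing of `Λ_m`
from `Λ_n` to `∂ⁱⁿΛ_m` definitionally). -/
theorem real_openCrossing_add {d : ℕ} (p : unitInterval) (v : Site d) (n m : ℕ) :
    (bondPercolation (zdGraph d) p).real
        (openCrossing ((· + v) '' (↑(box d m) : Set (Site d)))
          ((· + v) '' (↑(box d n) : Set (Site d)))
          ((· + v) '' (↑(innerBoundary (zdGraph d) (box d m)) : Set (Site d)))) =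
      (bondPercolation (zdGraph d) p).real
        {ω | ∃ x ∈ box d n, ∃ y ∈ innerBoundary (zdGraph d) (box d m),
          ω ∈ openConnIn (↑(box d m) : Set (Site d)) x y} :=
  real_openCrossing_shift p v (↑(box d m) : Set (Site d)) (↑(box d n) : Set (Site d))
    (↑(innerBoundary (zdGraph d) (box d m)) : Set (Site d))

/-- **Union bound**: `P_p(⋃_{v ∈ I} T_v) ≤ |I| · P_p(cross(n, m))` (`measureReal_biUnion_finset_le`
and `real_openCrossing_add`). -/
theorem real_biUnion_le {d : ℕ} (p : unitInterval) (n m : ℕ) (I : Finset (Site d)) :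
    (bondPercolation (zdGraph d) p).real (⋃ v ∈ I,
        openCrossing ((· + v) '' (↑(box d m) : Set (Site d)))
          ((· + v) '' (↑(box d n) : Set (Site d)))
          ((· + v) '' (↑(innerBoundary (zdGraph d) (box d m)) : Set (Site d)))) ≤
      I.card * (bondPercolation (zdGraph d) p).real
        {ω | ∃ x ∈ box d n, ∃ y ∈ innerBoundary (zdGraph d) (box d m),
          ω ∈ openConnIn (↑(box d m) : Set (Site d)) x y} := by
  refine le_trans (measureReal_biUnion_finset_le I _) (le_of_eq ?_)
  rw [Finset.sum_congr rfl fun v _ => real_openCrossing_add p v n m, Finset.sum_const,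
    nsmul_eq_mul]

/-- **Locality**: if `v + Λ_m ⊆ S` then `T_v` is determined by the pairs inside `S`
(`DCT16.determinedBy_openConnIn`, unions of determined events; Grimmett 1999 §2.2). -/
theorem determinedBy_openCrossing_add {d n m : ℕ} (v : Site d) {S : Finset (Site d)}
    (hS : ∀ z ∈ box d m, z + v ∈ S) :
    DeterminedBy (openCrossing ((· + v) '' (↑(box d m) : Set (Site d)))
        ((· + v) '' (↑(box d n) : Set (Site d)))
        ((· + v) '' (↑(innerBoundary (zdGraph d) (box d m)) : Set (Site d))))
      (↑S.sym2 : Set (Sym2 (Site d))) := by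
  have hS' : ∀ a ∈ (· + v) '' (↑(box d m) : Set (Site d)), a ∈ (↑S : Set (Site d)) := by
    intro a ha
    have h := hS (a - v) ((mem_image_add_iff v a _).1 ha)
    rwa [sub_add_cancel] at h
  have hsub : ((· + v) '' (↑(box d m) : Set (Site d))).sym2 ⊆ (↑S.sym2 : Set (Sym2 (Site d))) := by
    rw [Finset.coe_sym2]
    intro e
    induction e using Sym2.ind with
    | _ a b =>
      intro hab
      rw [Set.mk_mem_sym2_iff] at hab ⊢
      exact ⟨hS' a hab.1, hS' b hab.2⟩
  have hrepr : openCrossing ((· + v) '' (↑(box d m) : Set (Site d)))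
        ((· + v) '' (↑(box d n) : Set (Site d)))
        ((· + v) '' (↑(innerBoundary (zdGraph d) (box d m)) : Set (Site d))) =
      ⋃ x ∈ (· + v) '' (↑(box d n) : Set (Site d)),
        ⋃ y ∈ (· + v) '' (↑(innerBoundary (zdGraph d) (box d m)) : Set (Site d)),
          openConnIn ((· + v) '' (↑(box d m) : Set (Site d))) x y := by
    ext ω
    simp only [mem_openCrossing_iff, Set.mem_iUnion, exists_prop]
  rw [hrepr]
  exact DeterminedBy.iUnion fun x => DeterminedBy.iUnion fun _ => DeterminedBy.iUnion fun y =>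
    DeterminedBy.iUnion fun _ => determinedBy_openConnIn _ x y hsub

/-- Locality of the union events `U = ⋃_{v ∈ I} T_v`: if `v + Λ_m ⊆ S` for all `v ∈ I`, then `U`
is determined by the pairs inside `S`. -/
theorem determinedBy_biUnion {d n m : ℕ} (I S : Finset (Site d))
    (hIS : ∀ v ∈ I, ∀ z ∈ box d m, z + v ∈ S) :
    DeterminedBy (⋃ v ∈ I,
        openCrossing ((· + v) '' (↑(box d m) : Set (Site d)))
          ((· + v) '' (↑(box d n) : Set (Site d)))
          ((· + v) '' (↑(innerBoundary (zdGraph d) (box d m)) : Set (Site d))))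
      (↑S.sym2 : Set (Sym2 (Site d))) :=
  DeterminedBy.iUnion fun v => DeterminedBy.iUnion fun hv =>
    determinedBy_openCrossing_add v (hIS v hv)

/-- **Independence and union bound**: if the events `T_v`, `v ∈ I₁`, live on `S₁` and the events
`T_v`, `v ∈ I₂`, live on `S₂` with `S₁ ∩ S₂ = ∅`, then
`P_p(U₁ ∩ U₂) = P_p(U₁) P_p(U₂) ≤ (|I₁| u) (|I₂| u)`, `u = P_p(cross(n, m))`
(`DCT16.real_inter_of_determinedBy_disjoint`, Grimmett 1999 §2.2; `real_biUnion_le`). -/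
theorem real_inter_biUnion_le {d : ℕ} (p : unitInterval) (n m : ℕ) (I₁ I₂ S₁ S₂ : Finset (Site d))
    (h₁ : ∀ v ∈ I₁, ∀ z ∈ box d m, z + v ∈ S₁)
    (h₂ : ∀ v ∈ I₂, ∀ z ∈ box d m, z + v ∈ S₂) (hS : Disjoint S₁ S₂) :
    (bondPercolation (zdGraph d) p).real ((⋃ v ∈ I₁,
        openCrossing ((· + v) '' (↑(box d m) : Set (Site d)))
          ((· + v) '' (↑(box d n) : Set (Site d)))
          ((· + v) '' (↑(innerBoundary (zdGraph d) (box d m)) : Set (Site d)))) ∩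
      (⋃ v ∈ I₂,
        openCrossing ((· + v) '' (↑(box d m) : Set (Site d)))
          ((· + v) '' (↑(box d n) : Set (Site d)))
          ((· + v) '' (↑(innerBoundary (zdGraph d) (box d m)) : Set (Site d))))) ≤
      (I₁.card * (bondPercolation (zdGraph d) p).real
        {ω | ∃ x ∈ box d n, ∃ y ∈ innerBoundary (zdGraph d) (box d m),
          ω ∈ openConnIn (↑(box d m) : Set (Site d)) x y}) *
      (I₂.card * (bondPercolation (zdGraph d) p).real
        {ω | ∃ x ∈ box d n, ∃ y ∈ innerBoundary (zdGraph d) (box d m),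
          ω ∈ openConnIn (↑(box d m) : Set (Site d)) x y}) := by
  rw [real_inter_of_determinedBy_disjoint (zdGraph d) p (determinedBy_biUnion I₁ S₁ h₁)
    (determinedBy_biUnion I₂ S₂ h₂) (disjoint_sym2 hS)]
  exact mul_le_mul (real_biUnion_le p n m I₁) (real_biUnion_le p n m I₂) measureReal_nonneg
    (by positivity)

/-- **Counting**: a subset of the grid `n • Λ_G` has at most `(2G+1)^d` points (`card_box`). -/
theorem card_le_of_subset_image {d n G : ℕ} {I : Finset (Site d)}
    (hI : I ⊆ (box d G).image fun z : Site d => (n : ℤ) • z) :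
    (I.card : ℝ) ≤ (2 * (G : ℝ) + 1) ^ d := by
  have h1 : I.card ≤ (2 * G + 1) ^ d :=
    (Finset.card_le_card hI).trans (Finset.card_image_le.trans (card_box d G).le)
  exact_mod_cast h1

/-- **Core inequality** (general `d`, inner radius `n ≥ 1`, outer radius `m ≥ 2n`, grid bound
`2m + 23n + 1 ≤ G n`): `P_p(cross(20n, 20m)) ≤ ((2G+1)^d · P_p(cross(n, m)))²`. On lattice
configurations a crossing from `Λ_{20n}` to `∂ⁱⁿΛ_{20m}` contains two local crossings `T_{x₁}`,
`T_{x₂}` at grid points `x₁ ∈ nΛ_G ∩ Λ_{21n} ∖ Λ_{19n}`, `x₂ ∈ nΛ_G ∩ Λ_{2m+24n} ∖ Λ_{2m+22n}`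
(`mem_inter_of_mem_crossing`); the two families live on the disjoint sets `Λ_{m+21n}` and
`Λ_{3m+24n} ∖ Λ_{m+22n}`, so their unions are independent (`real_inter_biUnion_le`), each of
probability at most `(2G+1)^d · P_p(cross(n, m))` by the union bound and translation invariance. -/
theorem real_crossing_le_sq {d n m G : ℕ} (p : unitInterval) (hn : 1 ≤ n) (hm : 2 * n ≤ m)
    (hG : 2 * m + 23 * n + 1 ≤ G * n) :
    (bondPercolation (zdGraph d) p).real
        {ω | ∃ x ∈ box d (20 * n), ∃ y ∈ innerBoundary (zdGraph d) (box d (20 * m)),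
          ω ∈ openConnIn (↑(box d (20 * m)) : Set (Site d)) x y} ≤
      ((2 * (G : ℝ) + 1) ^ d * (bondPercolation (zdGraph d) p).real
        {ω | ∃ x ∈ box d n, ∃ y ∈ innerBoundary (zdGraph d) (box d m),
          ω ∈ openConnIn (↑(box d m) : Set (Site d)) x y}) ^ 2 := by
  have hI₁ : (((((box d G).image fun z : Site d => (n : ℤ) • z) ∩ box d (21 * n)) \
      box d (19 * n)).card : ℝ) ≤ (2 * (G : ℝ) + 1) ^ d :=
    card_le_of_subset_image (Finset.sdiff_subset.trans Finset.inter_subset_left)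
  have hI₂ : (((((box d G).image fun z : Site d => (n : ℤ) • z) ∩ box d (2 * m + 24 * n)) \
      box d (2 * m + 22 * n)).card : ℝ) ≤ (2 * (G : ℝ) + 1) ^ d :=
    card_le_of_subset_image (Finset.sdiff_subset.trans Finset.inter_subset_left)
  have hS : Disjoint (box d (21 * n + m)) (box d (3 * m + 24 * n) \ box d (m + 22 * n)) :=
    Finset.disjoint_left.2 fun a ha₁ ha₂ =>
      (Finset.mem_sdiff.1 ha₂).2 (box_mono d (by omega) ha₁)
  have h₁ : ∀ v ∈ (((box d G).image fun z : Site d => (n : ℤ) • z) ∩ box d (21 * n)) \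
      box d (19 * n), ∀ z ∈ box d m, z + v ∈ box d (21 * n + m) :=
    fun v hv z hz => add_mem_box (L := 21 * n) le_rfl
      (Finset.mem_inter.1 (Finset.mem_sdiff.1 hv).1).2 hz
  have h₂ : ∀ v ∈ (((box d G).image fun z : Site d => (n : ℤ) • z) ∩ box d (2 * m + 24 * n)) \
      box d (2 * m + 22 * n), ∀ z ∈ box d m, z + v ∈ box d (3 * m + 24 * n) \ box d (m + 22 * n) :=
    fun v hv z hz => add_mem_sdiff (L := 2 * m + 24 * n) (Mₗ := 2 * m + 22 * n)
      (by omega) (by omega) (Finset.mem_inter.1 (Finset.mem_sdiff.1 hv).1).2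
      (Finset.mem_sdiff.1 hv).2 hz
  have hmain := real_inter_biUnion_le p n m _ _ _ _ h₁ h₂ hS
  calc _ ≤ _ := real_mono_of_forall_subset_edgeSet (zdGraph d) p fun ω hω h =>
          mem_inter_of_mem_crossing hn hm hG hω h
    _ ≤ _ := hmain
    _ ≤ _ := mul_le_mul (mul_le_mul_of_nonneg_right hI₁ measureReal_nonneg)
          (mul_le_mul_of_nonneg_right hI₂ measureReal_nonneg) (by positivity) (by positivity)
    _ = _ := (sq _).symm

end AspectRenorm

/-- **Registered stub `aspectCrossing_renorm`** (line `critical-orange-peeling`, crux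
`NearLinearTwoClusterDecay`, vdBvE programme V1): the aspect-`M` RENORMALISATION INEQUALITY
`u_M(20n) ≤ ((100M)³ · u_M(n))²` for the crossing probabilities
`u_M(n) = P_p(Λ_n ⟷ ∂ⁱⁿΛ_{Mn} in Λ_{Mn})` of bond percolation on `ℤ³` (every `p`, every `M ≥ 2`,
every `n ≥ 1`). Proof: `AspectRenorm.real_crossing_le_sq` with `d = 3`, `m = Mn`, grid bound
`G = 2M + 25` (`(2M+23)n + 1 ≤ (2M+25)n`), and `(2G+1)³ = (4M+51)³ ≤ (100M)³`. -/
theorem aspectCrossing_renorm : ∀ (M : ℕ) (p : unitInterval) (n : ℕ), 2 ≤ M → 1 ≤ n →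
    (bondPercolation (zdGraph 3) p).real
        {ω | ∃ x ∈ box 3 (20 * n), ∃ y ∈ innerBoundary (zdGraph 3) (box 3 (M * (20 * n))),
          ω ∈ openConnIn (↑(box 3 (M * (20 * n))) : Set (Site 3)) x y} ≤
      (((100 : ℝ) * M) ^ 3 * (bondPercolation (zdGraph 3) p).real
        {ω | ∃ x ∈ box 3 n, ∃ y ∈ innerBoundary (zdGraph 3) (box 3 (M * n)),
          ω ∈ openConnIn (↑(box 3 (M * n)) : Set (Site 3)) x y}) ^ 2 := by
  intro M p n hM hn
  have hmn : 2 * n ≤ M * n := Nat.mul_le_mul_right n hM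
  have hG : 2 * (M * n) + 23 * n + 1 ≤ (2 * M + 25) * n := by
    have h : (2 * M + 25) * n = 2 * (M * n) + 25 * n := by ring
    omega
  have h20 : M * (20 * n) = 20 * (M * n) := by ring
  have key := AspectRenorm.real_crossing_le_sq (d := 3) (n := n) (m := M * n) (G := 2 * M + 25)
    p hn hmn hG
  rw [h20]
  refine key.trans (pow_le_pow_left₀ (by positivity) (mul_le_mul_of_nonneg_right ?_
    measureReal_nonneg) 2)
  have hM' : (2 : ℝ) ≤ M := by exact_mod_cast hM
  refine pow_le_pow_left₀ (by positivity) ?_ 3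
  push_cast
  linarith

end Summit.CriticalPhenomena.PercolationContinuityZ3.Theorems.NearLinearTwoClusterDecay.Negative

end
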